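import Mathlib
import Literature.LinearAlgebra.Matrix.SylvesterDeterminantIdentity
import Summits.ValiantsHypothesis.ValiantsHypothesis.Theorems.LacunarySymmetroidMatrixDescartesCensusDefs
import Summits.ValiantsHypothesis.ValiantsHypothesis.Theorems.LacunarySymmetroidMatrixDescartesDescartesSharpOnSupport
import Summits.ValiantsHypothesis.ValiantsHypothesis.Theorems.KPlusLogSqLawWeakLiftingTowerGraftSizeMono
import Summits.ValiantsHypothesis.ValiantsHypothesis.Theorems.KPlusLogSqLawWeakLiftingTowerGraftDoublingChain
import Summits.ValiantsHypothesis.ValiantsHypothesis.Theorems.KPlusLogSqLawWeakLiftingTowerGraftMinorPencil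
import Summits.ValiantsHypothesis.ValiantsHypothesis.Theorems.KPlusLogSqLawWeakLiftingTowerGraftMinorPencilLaw
import Summits.ValiantsHypothesis.ValiantsHypothesis.Theorems.KPlusLogSqLawWeakLiftingTowerGraftTowerDissociated

/-!
# Tower graft line — the SUPPORT-LEVEL (census-currency) reading of T5 is FALSE, for every constant (kernel form of memo #59)

Negative record for LINE (B) `Cruxes/WeakLifting/Lines/tower_graft.lean` (rev 9; crux `WeakLifting` = stmt-ValiantsHypothesis-19561,
restricted sub-case `TowerWeakLifting`), S4f / T5 side.  NO registered stub is touched: the statement refuted here — «on fat tower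
formats a support-level positive-root budget transports, with factor `(m+2)^C` and additive `2^{C·log₂²(m+1)}`, to EVERY family of
exponents drawn from the `(m+1)`-fold sumset of the support» — is ONE CANDIDATE TYPING of the research statement T5 («a class law for the
Sylvester minor pencil»), a CANDIDATE TYPING, NEVER REGISTERED (planner val-idea-24 rev 2e: «no support-level T5 will be registered — ever»; desk R2752; see the
evidence memo #59 on stmt-19561 and `Cruxes/WeakLifting/Lines/tower_graft-S5.md` §6).  It is
recorded in the kernel because it says WHY a true T5 must charge the MINOR structure of `𝔅`'s letters and not only their support.

Proof (`not_supportLevel_T5`, def-free, the candidate law inlined as hypothesis `h`):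
1. `h` ⇒ T5-𝔅(C) (this seat's `card_posRoots_minorPencil_le_of_posRootLawOn_sumset`, p660533: the minor pencil's symmetrised letters
   live on the sumset; `sum_colouring_eq_sum_card_fiber` turns colourings into class-count vectors) ⇒ S4f(C) (`sizeDoublingPoly_of_minorPencilLaw`,
   p660979) ⇒ TowerB(C') for some `C'` (val-sym-lift-p2 g18's `doublingChain`, p657997, with `sizeMono`, p658112).
2. Fat tower format: `c = C + C' + 2`, `j = 4c + 20`, `K = 2^j + 1` letters, size `m + 1 = 2^{c+j}`, `dₗ = (m+2)^l`; TowerB gives the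
   budget `B = 2^{C'(K + (c+j)²)}` at size `m+1`; `h` transports it to the DIGIT family `e_g = (m+1 − Σ g)·d₀ + Σᵢ gᵢ·d_{i+1}`,
   `g : Fin 2^j → Fin 2^c` — `2^{c·2^j}` exponents, pairwise distinct because towers are dissociated (`tower_classSum_injective`, p661533).
3. Descartes is sharp on every support (val-sym-lift-p2 g18's `DescartesSharp.le_of_posRootLawOn`, p660665: diagonal designs give
   `(m+1)·(K'−1) ≤` any valid budget), and `2^{c+j}·(2^{c·2^j} − 1) > (m+2)^C·B + 2^{C(c+j)²}` (`negT5_exponent_lt`: the gap is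
   `(C+2)·2^j` against a polynomial in `c`).  Contradiction.
No conjecture is used.  Nothing here bears on S4f / T5 proper (research, OPEN), `WeakLifting`, Conjecture B / `KPlusLogSqLaw`,
`MatrixDescartes` (18050) or `VP ≠ VNP`.  Seat: prover val-sym-lift-p3 g17, `--supports stmt-ValiantsHypothesis-19561`.
-/

-- `Summit.ValiantsHypothesis.ValiantsHypothesis.…` repeats a component by the D-0017 layout
-- (single-conjunct summit), which the `dupNamespace` linter flags; the name is mandated.
set_option linter.dupNamespace false

namespace Summit.ValiantsHypothesis.ValiantsHypothesis.Theorems.KPlusLogSqLaw.TowerGraft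

open Finset Polynomial Matrix
open scoped BigOperators Polynomial
open Summit.ValiantsHypothesis.ValiantsHypothesis.Theorems.LacunarySymmetroidMatrixDescartes (PosRootLawOn)
open Literature.LinearAlgebra.Matrix (borderedMinors)

/-! ### §1 Colourings and class-count vectors -/

/-- the exponent of a colouring is the class-count combination of its fibre sizes. [folklore] -/
theorem sum_colouring_eq_sum_card_fiber {ι : Type*} [Fintype ι] [DecidableEq ι] {K : ℕ} (d : Fin K → ℕ) (f : ι → Fin K) :
    ∑ a, d (f a) = ∑ l, (Finset.univ.filter (fun a => f a = l)).card * d l := by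
  classical
  rw [← Finset.sum_fiberwise_of_maps_to (g := f) (t := Finset.univ) (fun a _ => Finset.mem_univ (f a))]
  refine Finset.sum_congr rfl fun l _ => ?_
  rw [Finset.sum_const_nat (fun a ha => by rw [(Finset.mem_filter.mp ha).2])]

/-- the fibre sizes of a colouring add up to the number of coloured positions. [folklore] -/
theorem sum_card_fiber_eq_card {ι : Type*} [Fintype ι] [DecidableEq ι] {K : ℕ} (f : ι → Fin K) :
    ∑ l, (Finset.univ.filter (fun a => f a = l)).card = Fintype.card ι := by
  classical
  rw [← Finset.card_univ, Finset.card_eq_sum_card_fiberwise (f := f) (t := Finset.univ) (fun a _ => Finset.mem_univ (f a))]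

/-! ### §2 The refutation -/

/-- the exponent bookkeeping of the refutation: with `c = C + C' + 2`, `P = 5c + 20`, `r ≥ 2^20 (c+1)^4`,
`C (P+1) + C' (r + 1 + P²) + C P² + 1 + 2 ≤ P + c r`. [folklore] -/
theorem negT5_exponent_lt (C C' c P r : ℕ) (hc : c = C + C' + 2) (hP : P = 5 * c + 20) (hr : 2 ^ 20 * (c + 1) ^ 4 ≤ r) :
    C * (P + 1) + C' * (r + 1 + P ^ 2) + C * P ^ 2 + 1 + 2 ≤ P + c * r := by
  have hC : C ≤ c := by omega
  have hC' : C' ≤ c := by omega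
  -- everything except `C' r` is `≤ 830 (c+1)^4 ≤ 2^20 (c+1)^4 ≤ r`, and `c r ≥ C' r + 2 r`
  have hW : C * (P + 1) + C' * (1 + P ^ 2) + C * P ^ 2 + 3 ≤ 830 * (c + 1) ^ 4 := by
    subst hP
    nlinarith [hC, hC', Nat.zero_le C, Nat.zero_le C', Nat.zero_le c, sq_nonneg (c : ℤ)]
  have h830 : 830 * (c + 1) ^ 4 ≤ r := le_trans (Nat.mul_le_mul_right _ (by norm_num)) hr
  have hcr : c * r = C' * r + (C + 2) * r := by rw [hc]; ring
  nlinarith [hW, h830, hcr, Nat.zero_le r, Nat.zero_le P]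

/-- **THE SUPPORT-LEVEL (census-currency) READING OF T5 IS FALSE, for every constant `C`.**  Hypothesis `h` = «on every fat
tower format (`2^C·K ≤ m+1`, `IsTower (m+1) d`), a positive-root budget `B` for the size-`(m+1)` pencils on `d` transports to the
budget `(m+2)^C·B + 2^{C·log₂²(m+1)}` for the size-`(m+1)` pencils on EVERY family of exponents drawn from the `(m+1)`-fold sumset of
`d`» (class-count form `e q = Σ nₗ·dₗ`, `Σ nₗ = m+1`).  Refutation: (1) `h` ⇒ T5-𝔅(C) (`card_posRoots_minorPencil_le_of_posRootLawOn_sumset`,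
the minor pencil's symmetrised letters live on the sumset) ⇒ S4f(C) (`sizeDoublingPoly_of_minorPencilLaw`) ⇒ TowerB(C')
(`doublingChain` + `sizeMono`); (2) at the fat tower format `m+1 = 2^{c+j}`, `K = 2^j + 1`, `c = C + C' + 2`, `j = 4c + 20`,
`dₗ = (m+2)^l`, feed the TowerB budget into `h` on the DIGIT family `e_g = Σ_{i} g_i·d_{i+1} + (m+1 − Σ g)·d₀`, `g : Fin 2^j → Fin 2^c`
(`2^{c·2^j}` exponents, injective by `tower_classSum_injective`); (3) Descartes is sharp on every support (val-sym-lift-p2 g18's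
`DescartesSharp.le_of_posRootLawOn`: `(m+1)·(K'−1) ≤` budget), and `2^{c+j}·(2^{c·2^j} − 1)` beats
`(m+2)^C·2^{C'(K + (c+j)²)} + 2^{C(c+j)²}` (`negT5_exponent_lt`).  No conjecture is used; `h` is a candidate typing, never registered, nobody's
claim (memo #59 on stmt-19561; `Lines/tower_graft-S5.md` §6) — this records WHY a true T5 must charge the MINOR structure of `𝔅`.
[this work] -/
theorem not_supportLevel_T5 (C : ℕ)
    (h : ∀ (m K B : ℕ) (d : Fin K → ℕ), 2 ^ C * K ≤ m + 1 → (∀ l l' : Fin K, l < l' → (m + 1) * d l < d l') →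
      PosRootLawOn (m + 1) K B d →
      ∀ (K' : ℕ) (e : Fin K' → ℕ), (∀ q, ∃ n : Fin K → ℕ, ∑ l, n l = m + 1 ∧ e q = ∑ l, n l * d l) →
        PosRootLawOn (m + 1) K' ((m + 2) ^ C * B + 2 ^ (C * Nat.log 2 (m + 1) ^ 2)) e) :
    False := by
  classical
  -- Step 1: `h` ⇒ T5-𝔅(C) ⇒ S4f(C) ⇒ TowerB(C')
  have hT5B : ∃ C₀ : ℕ, ∀ (m K B : ℕ) (d : Fin K → ℕ), 2 ^ C₀ * K ≤ m + 1 →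
      (∀ l l' : Fin K, l < l' → (m + 1) * d l < d l') → PosRootLawOn (m + 1) K B d →
      ∀ (S : Fin K → Matrix (Fin (m + 1 + m)) (Fin (m + 1 + m)) ℝ), (∀ l, (S l).IsSymm) →
        (∑ l, ((X : ℝ[X]) ^ d l) • ((S l).submatrix
            ((finSumFinEquiv.trans (finCongr (Nat.add_comm m (m + 1)))) ∘ Sum.inl)
            ((finSumFinEquiv.trans (finCongr (Nat.add_comm m (m + 1)))) ∘ Sum.inl)).map Polynomial.C).det ≠ 0 →
        let A := (∑ l, ((X : ℝ[X]) ^ d l) • (S l).map Polynomial.C).submatrix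
          (finSumFinEquiv.trans (finCongr (Nat.add_comm m (m + 1))))
          (finSumFinEquiv.trans (finCongr (Nat.add_comm m (m + 1))))
        ((borderedMinors A.toBlocks₁₁ A.toBlocks₁₂ A.toBlocks₂₁ A.toBlocks₂₂).det.roots.toFinset.filter
          (fun t => 0 < t)).card ≤ (m + 2) ^ C₀ * B + 2 ^ (C₀ * Nat.log 2 (m + 1) ^ 2) := by
    refine ⟨C, fun m K B d hK hd hB S hS _ => ?_⟩
    refine card_posRoots_minorPencil_le_of_posRootLawOn_sumset d (h m K B d hK hd hB _ _ fun q => ?_) S hS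
    refine ⟨fun l => (Finset.univ.filter (fun a => (Fintype.equivFin (Fin m ⊕ Unit → Fin K)).symm q a = l)).card, ?_, ?_⟩
    · rw [sum_card_fiber_eq_card]
      simp
    · exact sum_colouring_eq_sum_card_fiber d _
  obtain ⟨C', hTB⟩ := doublingChain (sizeDoublingPoly_of_minorPencilLaw hT5B) sizeMono
  -- Step 2: the fat tower format (all parameters kept opaque behind equations)
  obtain ⟨c, hc⟩ : ∃ c : ℕ, c = C + C' + 2 := ⟨_, rfl⟩
  obtain ⟨j, hj⟩ : ∃ j : ℕ, j = 4 * c + 20 := ⟨_, rfl⟩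
  obtain ⟨r, hr⟩ : ∃ r : ℕ, r = 2 ^ j := ⟨_, rfl⟩
  obtain ⟨P, hP⟩ : ∃ P : ℕ, P = c + j := ⟨_, rfl⟩
  obtain ⟨m, hm1⟩ : ∃ m : ℕ, m + 1 = 2 ^ P := ⟨2 ^ P - 1, Nat.sub_add_cancel Nat.one_le_two_pow⟩
  have hrpos : 1 ≤ r := by rw [hr]; exact Nat.one_le_two_pow
  have hcpos : 2 ≤ c := by omega
  set d : Fin (r + 1) → ℕ := fun l => (m + 2) ^ (l : ℕ) with hddef
  have hd : ∀ l l' : Fin (r + 1), l < l' → (m + 1) * d l < d l' := by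
    intro l l' hll'
    have h1 : (m + 1) * (m + 2) ^ (l : ℕ) < (m + 2) ^ ((l : ℕ) + 1) := by
      rw [pow_succ]
      nlinarith [pow_pos (show 0 < m + 2 by omega) (l : ℕ)]
    exact lt_of_lt_of_le h1 (Nat.pow_le_pow_right (by omega) (by exact_mod_cast hll'))
  -- TowerB at size m + 1
  have hTower : PosRootLawOn (m + 1) (r + 1) (2 ^ (C' * ((r + 1) + Nat.log 2 (m + 1) ^ 2))) d := hTB (m + 1) (r + 1) d hd
  -- the digit family: g : Fin r → Fin (2^c) ↦ class counts (m+1 − Σ g, g₀, …, g_{r−1})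
  have hgsum : ∀ g : Fin r → Fin (2 ^ c), ∑ i, ((g i : ℕ)) ≤ m + 1 := by
    intro g
    calc ∑ i, ((g i : ℕ)) ≤ ∑ _i : Fin r, 2 ^ c := Finset.sum_le_sum fun i _ => (g i).isLt.le
      _ = r * 2 ^ c := by simp
      _ = m + 1 := by rw [hm1, hP, pow_add, hr]; ring
  set nvec : (Fin r → Fin (2 ^ c)) → Fin (r + 1) → ℕ := fun g =>
    Fin.cases (m + 1 - ∑ i, (g i : ℕ)) (fun i => (g i : ℕ)) with hnvec
  have hnsum : ∀ g, ∑ l, nvec g l = m + 1 := by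
    intro g
    rw [Fin.sum_univ_succ]
    simp only [hnvec, Fin.cases_zero, Fin.cases_succ]
    have := hgsum g
    omega
  set e : Fin ((2 ^ c) ^ r) → ℕ := fun q => ∑ l, nvec (finFunctionFinEquiv.symm q) l * d l with he
  have he_inj : Function.Injective e := by
    intro q q' hqq'
    have hn := tower_classSum_injective (r + 1) (m + 1) d hd _ _ (hnsum _) (hnsum _) hqq'
    have hg : finFunctionFinEquiv.symm q = finFunctionFinEquiv.symm q' := by
      funext i
      have := congrFun hn i.succ
      simp only [hnvec, Fin.cases_succ] at this
      exact Fin.ext this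
    exact finFunctionFinEquiv.symm.injective hg
  -- Step 3: apply `h` on the digit family with the TowerB budget
  have hguard : 2 ^ C * (r + 1) ≤ m + 1 := by
    rw [hm1, hP, pow_add]
    have h1 : r + 1 ≤ 2 * r := by omega
    have h2 : 2 ^ C * 2 ≤ 2 ^ c := by
      rw [← pow_succ]; exact Nat.pow_le_pow_right two_pos (by omega)
    calc 2 ^ C * (r + 1) ≤ 2 ^ C * (2 * r) := Nat.mul_le_mul_left _ h1
      _ = (2 ^ C * 2) * r := by ring
      _ ≤ 2 ^ c * r := Nat.mul_le_mul_right _ h2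
      _ = 2 ^ c * 2 ^ j := by rw [hr]
  have hlaw := h m (r + 1) _ d hguard hd hTower ((2 ^ c) ^ r) e
    (fun q => ⟨nvec (finFunctionFinEquiv.symm q), hnsum _, rfl⟩)
  -- Step 4: Descartes is sharp on every support (diagonal designs)
  have hcr : 1 ≤ c * r := Nat.one_le_iff_ne_zero.mpr (Nat.mul_ne_zero (by omega) (by omega))
  have hK' : 2 ≤ (2 ^ c) ^ r := by
    rw [← pow_mul]
    calc 2 = 2 ^ 1 := (pow_one 2).symm
      _ ≤ 2 ^ (c * r) := Nat.pow_le_pow_right two_pos hcr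
  have hfloor := Summit.ValiantsHypothesis.ValiantsHypothesis.Theorems.LacunarySymmetroidMatrixDescartes.DescartesSharp.le_of_posRootLawOn
    (Nat.succ_pos m) hK' he_inj hlaw
  -- Step 5: arithmetic
  have hL : Nat.log 2 (m + 1) = P := by rw [hm1, Nat.log_pow one_lt_two]
  rw [hL] at hfloor
  -- lower bound of the left side
  have hLHS : 2 ^ (P + (c * r - 1)) ≤ (m + 1) * ((2 ^ c) ^ r - 1) := by
    rw [pow_add, hm1, ← pow_mul]
    refine Nat.mul_le_mul_left _ ?_
    have h1 : 2 ^ (c * r) = 2 * 2 ^ (c * r - 1) := by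
      rw [← pow_succ']; congr 1; omega
    omega
  -- upper bound of the right side
  have hm2 : m + 2 ≤ 2 ^ (P + 1) := by rw [pow_succ]; omega
  have hRHS : (m + 2) ^ C * 2 ^ (C' * ((r + 1) + P ^ 2)) + 2 ^ (C * P ^ 2) ≤
      2 ^ ((C * (P + 1) + C' * ((r + 1) + P ^ 2)) + C * P ^ 2 + 1) := by
    refine add_le_two_pow_of_le ?_ le_rfl
    rw [pow_add]
    have h3 : (2 ^ (P + 1)) ^ C = 2 ^ (C * (P + 1)) := by rw [← pow_mul, mul_comm]
    exact Nat.mul_le_mul_right _ ((Nat.pow_le_pow_left hm2 C).trans h3.le)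
  -- the exponents compare the wrong way
  have hexp : (C * (P + 1) + C' * ((r + 1) + P ^ 2)) + C * P ^ 2 + 1 < P + (c * r - 1) := by
    have h1 := negT5_exponent_lt C C' c P r hc (by rw [hP, hj]; ring) ?_
    · omega
    · rw [hr, hj, pow_add, pow_mul', mul_comm]
      exact Nat.mul_le_mul_right _ (Nat.pow_le_pow_left Nat.lt_two_pow_self 4)
  have hlt : (m + 2) ^ C * 2 ^ (C' * ((r + 1) + P ^ 2)) + 2 ^ (C * P ^ 2) < (m + 1) * ((2 ^ c) ^ r - 1) :=
    lt_of_le_of_lt hRHS (lt_of_lt_of_le (Nat.pow_lt_pow_right one_lt_two hexp) hLHS)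
  exact absurd hfloor (not_le.mpr hlt)

end Summit.ValiantsHypothesis.ValiantsHypothesis.Theorems.KPlusLogSqLaw.TowerGraft
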